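/-
Origin: expansion seat `planner-pub-hodgecm-mc-axioms-1-g14-0`, handover #W239 2026-08-20T15:53:55Z md5 8bfb76a62c22 (PKG a461881c365e → 8bfb76a62c22; 230 l.; MECHANICAL (iib-R) rewrite v3.1 of the PKG file as it stands (33 token edits; rules R1x1+RX[h₂]x32)) (`HOME/mc/pub-hodgecm-mc-axioms-1-g14/revendor/kit-r55/stage55/HodgeCM/Model/Binders/Gen12SeesawKInfty.lean`, md5 8bfb76a62c22, 230 lines);
landed by the gen-22 packager (p-g22) in gate run 55 REPLACES the earlier landed copy of `HodgeCM/Model/Binders/Gen12SeesawKInfty.lean` (seat copy carried the packager Origin header of an earlier run (stripped)).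
-/
/-
Origin: speedrun cell pub-hodgecm, MODEL-CONSTRUCTION sub-cell, unit pub-hodgecm-mc-binder-1-g9 (BINDER PROVER, gen 9; node B2-meet,
BINDER-OWNERS row 14 `gen12`: RECORD 2′ at the honest pins with EVERY see-saw junction discharged), seat prover-pub-hodgecm-mc-binder-1-g9-0, 2026-08-19.
Target in PKG: HodgeCM/Model/Binders/Gen12SeesawKInfty.lean (NEW additive leaf, RUN 37+ in the (Θ-sat) world; imports #20
`Binders/Gen12SeesawOfArchSide`, kit #18 `Binders/Gen12WedgeKTypeOfStrict` (RUN-37 Section A, after theta-3 #S1 `ThetaSpaceSat`) and #21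
`Junction/KInftySplit`; nothing landed imports it).  KERNEL ONLY: 0 records, nothing cited, 0 `def … : Prop`, MODEL-N ±0, E unchanged.
-/
import Summits.HodgeConjecture.HodgeCM.Model.Binders.Gen12SeesawOfArchSide
import Summits.HodgeConjecture.HodgeCM.Model.Binders.Gen12WedgeKTypeOfStrict
import Summits.HodgeConjecture.HodgeCM.Model.Junction.KInftySplit

/-!
# Row `gen12`: RECORD 2′ `SeesawCore` at the honest pins along `K_∞`, ALL see-saw junctions discharged

With the W pin's ball frame taken AT THE FRAME OF RECORD `(τ, T, hT) := (ι₁, V.sylvesterFrame, sylvesterFrame_formCongr V)` — the frame of the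
S pin's `ιinf = archInfOf V` (#1097) — the three producers of row 14's see-saw record meet on the nose:

* (x-S)  `τ/prod/op`  := period-1 `tau12`/`prod_tau12`/`op_archSideOf`                      (#20 `SeesawCore.ofArchSideKInfty`);
* (x-W)  `hSK`        := tree `mem_cmKTypeTwist_iff` along `archIsotropyRegime`, `χ := archKappa`  (#20 `Gen12Pins.hSK_archKappa`);
* (x-Θ)  `hA`/`hB`    := kit #18 `hA_of_strict`/`hB_of_strict` (theta-3 (E4) + #V5) with `uOf := archIsotropyProj` (`π`),
         `aOf k := toLatticeModelG V (kInftyCorr V k)` — legitimate because `archIsotropyRegime … k = ιinf (π k) · aOf k` and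
         `aOf k ∈ satLevelRegimeOf V hV K` for EVERY `K` (#21 `Junction/KInftySplit`);
* (K-norm) `hdet`     := `det (Jac (π k) x₀) = archKappa k` (tree `coe_archKappa`, definitional).

Exports (namespace `HodgeCM.Model.Gen12Pins`): the Sylvester-frame families `τSyl`/`TSyl`/`hTSyl` for the W pin; `archIsotropyRegime_syl_eq`
(unitary-1's `gK` at the frame of record = `archInfOf V (π k) · toLatticeModelG V (kInftyCorr V k)`); `hA_KInfty`/`hB_KInfty` (kit #12's
`hA`/`hB` ALONG `archIsotropyRegime`, for any saturation index `KΓ` containing the correctors); and the constructors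
**`SeesawCore.ofArchSideSyl adm KΓ hKΓ hadm`** (RECORD 2′ at the pins for ANY admissibility predicate implying `IsSaturated (KΓ Γ) ∧ IsStrict`)
and **`SeesawCore.ofArchSidePin`** (the same at the (Θ-sat) pin's own index `KΓ := (pinX …).KΓ = satLevelRegimeOf V hV Γ.K` and
`adm := IsSaturated ∧ IsStrict` — NO hypothesis left).  ROW 14 after this leaf: `gen12` ⟸ RECORD 1 `Gen12Residual.ofSaturated …`
[(Θ-sat) `hΘ`, D-1′ `proj`] ⊕ (N1)₀,₁ [glue-1 `hN1`] via kit #9 `gen12_of_seesawCore R K hN1` with `K := SeesawCore.ofArchSidePin …`.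
Nothing here is a claim of the manuscripts under adjudication.
-/

set_option autoImplicit false

noncomputable section

open MeasureTheory NumberField MulAction
open scoped Matrix

namespace HodgeCM.Model

open HodgeCM HodgeCM.Universe HodgeCM.Adelic
open Literature.NumberTheory.Weil1964
open Literature.NumberTheory.Automorphic (piSchwartzBruhat)
open Literature.NumberTheory.Automorphic.UnitaryGroup (archIsotropy archIsotropyProj archKappa)
open Literature.NumberTheory.GelbartRogawski1991.UnitaryDualPair
open Literature.RepresentationTheory.HeisenbergGroup
open Literature.Geometry.ComplexHyperbolic.BallModel (U21 x₀ Jac)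
open Literature.AlgebraicGeometry.HodgeTheory
open Literature.NumberTheory.Automorphic.PicardCM
open HodgeCM.Model.ThetaSpace
open HodgeCM.Model.ArchSideTerm

namespace Gen12Pins

/-! ## 0. The W pin's ball frame OF RECORD: `(τ, T, hT) := (ι₁, V.sylvesterFrame, sylvesterFrame_formCongr V)` as families -/

/-- `τ := ι₁` (the CM type's distinguished embedding, as a family). -/
abbrev τSyl : ∀ {L : CMField} {ι₁ : L →+* ℂ} (_V : HermSpace3 L ι₁) (_c : SeesawCtx L), L →+* ℂ := fun {_} {ι₁} _ _ => ι₁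

/-- `T := V.sylvesterFrame` (as a family). -/
abbrev TSyl : ∀ {L : CMField} {ι₁ : L →+* ℂ} (_V : HermSpace3 L ι₁) (_c : SeesawCtx L), GL (Fin 3) ℂ := fun V _ => V.sylvesterFrame

/-- `hT := sylvesterFrame_formCongr V` (as a family). -/
theorem hTSyl : ∀ {L : CMField} {ι₁ : L →+* ℂ} (V : HermSpace3 L ι₁) (c : SeesawCtx L),
    Literature.NumberTheory.Automorphic.formCongr (starRingEnd ℂ) (TSyl V c) (V.Hm.map (τSyl V c)) =
      Literature.Geometry.ComplexHyperbolic.BallModel.J :=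
  fun V _ => sylvesterFrame_formCongr V

/-! ## 1. The index junction at the pin families -/

variable
  (hGR : ∀ {L : CMField} {ι₁ : L →+* ℂ} (V : HermSpace3 L ι₁) (c : SeesawCtx L),
    (cmSplittingDatum (L : Type) finProdFinEquiv (frameD V) (frameD_real V) (frameD_ne V) (dW c.D) (dW_real c.D)
      (dW_ne c.D)).CompatibleSplitting)
  (hρ : ∀ {L : CMField} {ι₁ : L →+* ℂ} (V : HermSpace3 L ι₁) (c : SeesawCtx L),
    HasThetaMajorants fun (p : CMAdelic (L : Type) (frameD V) × CMAdelic (L : Type) (dW c.D)) (Φ : CMSchwartz (L : Type) 6) =>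
      adelicMpCont.omega (↥(maximalRealSubfield L)) (Fin 6)
        (CMGram (L : Type) finProdFinEquiv (frameD V) (frameD_real V) (dW c.D) (dW_real c.D))
        (cmPairSplitting (L : Type) finProdFinEquiv (frameD V) (frameD_real V) (frameD_ne V) (dW c.D) (dW_real c.D) (dW_ne c.D)
          (hGR V c) p) Φ)
  (η : ∀ {L : CMField} {ι₁ : L →+* ℂ} (V : HermSpace3 L ι₁) (c : SeesawCtx L),
    CMAdelic (L : Type) (frameD V) × CMAdelic (L : Type) (dW c.D) →* ℂˣ)
  (hη : ∀ {L : CMField} {ι₁ : L →+* ℂ} (V : HermSpace3 L ι₁) (c : SeesawCtx L),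
    ∀ γU ∈ CMRat (L : Type) (frameD V), ∀ γ ∈ CMRat (L : Type) (dW c.D), η V c (γU, γ) = 1)
  (hηc : ∀ {L : CMField} {ι₁ : L →+* ℂ} (V : HermSpace3 L ι₁) (c : SeesawCtx L), Continuous fun p => ((η V c p : ℂˣ) : ℂ))
  (hδ : ∀ {L : CMField} {ι₁ : L →+* ℂ} (_V : HermSpace3 L ι₁) (_c : SeesawCtx L), 0 < (ι₁ (imagUnit L)).im)
  (hGR₀ : ∀ {L : CMField} {ι₁ : L →+* ℂ} (V : HermSpace3 L ι₁) (c : SeesawCtx L),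
    (cmSplittingDatum (L : Type) (e₁) (frameD V) (frameD_real V) (frameD_ne V) (lineVec (L : Type) (dW c.D 0))
      (fun _ => dW_real c.D 0) (fun _ => dW_ne c.D 0)).CompatibleSplitting)
  (hGR₁ : ∀ {L : CMField} {ι₁ : L →+* ℂ} (V : HermSpace3 L ι₁) (c : SeesawCtx L),
    (cmSplittingDatum (L : Type) (e₁) (frameD V) (frameD_real V) (frameD_ne V) (lineVec (L : Type) (dW c.D 1))
      (fun _ => dW_real c.D 1) (fun _ => dW_ne c.D 1)).CompatibleSplitting)
  (hGR₂ : ∀ {L : CMField} {ι₁ : L →+* ℂ} (V : HermSpace3 L ι₁) (c : SeesawCtx L),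
    (cmSplittingDatum (L : Type) (e₁) (frameD V) (frameD_real V) (frameD_ne V) (lineVec (L : Type) (dW' c.D 0))
      (fun _ => dW'_real c.D 0) (fun _ => dW'_ne c.D 0)).CompatibleSplitting)
  (hGR₃ : ∀ {L : CMField} {ι₁ : L →+* ℂ} (V : HermSpace3 L ι₁) (c : SeesawCtx L),
    (cmSplittingDatum (L : Type) (e₁) (frameD V) (frameD_real V) (frameD_ne V) (lineVec (L : Type) (dW' c.D 1))
      (fun _ => dW'_real c.D 1) (fun _ => dW'_ne c.D 1)).CompatibleSplitting)
  (h₁W : ∀ {L : CMField} {ι₁ : L →+* ℂ} (_V : HermSpace3 L ι₁) (c : SeesawCtx L),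
    (∀ j, 0 < (ι₁ (dW c.D j)).re) ∨ ∀ j, (ι₁ (dW c.D j)).re < 0)
  (A : ∀ {L : CMField} {ι₁ : L →+* ℂ} (V : HermSpace3 L ι₁) (c : SeesawCtx L) (k : Fin 4),
    ArchLineInput V (lineRepD V c.D (hGR V c) (hGR₀ V c) (hGR₁ V c) (hGR₂ V c) (hGR₃ V c) (η V c) k))

variable (hHD : exists_isReal_hodgeModel) (hI : hodgePQ_independent_of_hodgeModel)
  (h₁ : BallQuotientUniformised)  (h₃ : CMAbelianVarietyRealised)
variable {L : CMField} {ι₁ : L →+* ℂ} (V : HermSpace3 L ι₁) (c : SeesawCtx L) (hV : IsAnisotropic L V.Hm)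

local notation3 "L⁺" => maximalRealSubfield (L : Type)

/-- **unitary-1's `gK` at the frame of record IS `ιinf (π k) · a_k`**: `archIsotropyRegime V hV ι₁ V.sylvesterFrame _ k =
archInfOf V (π k) * toLatticeModelG V (kInftyCorr V k)` (#21 + `toLatticeModelG = regimeEquiv`; the composite in `archIsotropyRegime` is
`regimeEquiv ∘ cmAdelicEquiv.symm ∘ archIsotropyToAdelic` by definition). -/
theorem archIsotropyRegime_syl_eq (k : ↥(KInfty V)) :
    archIsotropyRegime V hV ι₁ V.sylvesterFrame (sylvesterFrame_formCongr V) k =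
      archInfOf V ((archIsotropyProj (L : Type) V.Hm ι₁ V.sylvesterFrame (sylvesterFrame_formCongr V) k : stabilizer U21 x₀) : U21) *
        toLatticeModelG V (kInftyCorr V k) := by
  rw [← toLatticeModelG_archIsotropyToAdelic_eq' V k, toLatticeModelG_eq_regimeEquiv V hV]
  rfl

/-- **kit #12's `hA` ALONG `archIsotropyRegime`** (line `0`) at the S-pin family, for any saturation index `KΓ` containing the correctors
`toLatticeModelG V (kInftyCorr V k)` — kit #18 `hA_of_strict` at `uOf := π`, `aOf := toLatticeModelG V ∘ kInftyCorr V`, rewritten along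
`archIsotropyRegime_syl_eq`. -/
theorem hA_KInfty (KΓ : Level V → Subgroup (quotU V).G) (hKΓ : ∀ (Γ : Level V) (k : ↥(KInfty V)), toLatticeModelG V (kInftyCorr V k) ∈ KΓ Γ) :
    ∀ (Γ : Level V)
      (Sit : KTypeSituation
        ((pinX hHD hI h₁ h₃ (S @hGR @η @hη @hηc @hGR₀ @hGR₁ @hGR₂ @hGR₃ @h₁W @A) V c hV).P 0)
        ((pinX hHD hI h₁ h₃ (S @hGR @η @hη @hηc @hGR₀ @hGR₁ @hGR₂ @hGR₃ @h₁W @A) V c hV).ιinf Γ)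
        ((pinX hHD hI h₁ h₃ (S @hGR @η @hη @hηc @hGR₀ @hGR₁ @hGR₂ @hGR₃ @h₁W @A) V c hV).Δ Γ)
        (pinX hHD hI h₁ h₃ (S @hGR @η @hη @hηc @hGR₀ @hGR₁ @hGR₂ @hGR₃ @h₁W @A) V c hV).κ₁
        (pinX hHD hI h₁ h₃ (S @hGR @η @hη @hηc @hGR₀ @hGR₁ @hGR₂ @hGR₃ @h₁W @A) V c hV).τ₁),
      (Sit.IsSaturated (KΓ Γ) ∧ Sit.IsStrict) → ∀ j ∈ Sit.𝓙, ∀ (k : ↥(KInfty V)) (i : Fin 2),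
        ((S @hGR @η @hη @hηc @hGR₀ @hGR₁ @hGR₂ @hGR₃ @h₁W @A V c).P 0).ω
            (archIsotropyRegime V hV ι₁ V.sylvesterFrame (sylvesterFrame_formCongr V) k, 1) (j.1 (Sit.ι (LinearMap.proj i))) =
          ∑ l, (Jac ((archIsotropyProj (L : Type) V.Hm ι₁ V.sylvesterFrame (sylvesterFrame_formCongr V) k : stabilizer U21 x₀) : U21) x₀) l i •
            j.1 (Sit.ι (LinearMap.proj l)) := by
  intro Γ Sit hadm j hj k i
  rw [archIsotropyRegime_syl_eq V hV k]
  exact hA_of_strict hHD hI h₁ h₃ (S @hGR @η @hη @hηc @hGR₀ @hGR₁ @hGR₂ @hGR₃ @h₁W @A) V c hV KΓ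
    (fun k => archIsotropyProj (L : Type) V.Hm ι₁ V.sylvesterFrame (sylvesterFrame_formCongr V) k)
    (fun k => toLatticeModelG V (kInftyCorr V k)) hKΓ Γ Sit hadm j hj k i

/-- **kit #12's `hB` ALONG `archIsotropyRegime`** (line `1`), same data. -/
theorem hB_KInfty (KΓ : Level V → Subgroup (quotU V).G) (hKΓ : ∀ (Γ : Level V) (k : ↥(KInfty V)), toLatticeModelG V (kInftyCorr V k) ∈ KΓ Γ) :
    ∀ (Γ : Level V)
      (Sit : KTypeSituation
        ((pinX hHD hI h₁ h₃ (S @hGR @η @hη @hηc @hGR₀ @hGR₁ @hGR₂ @hGR₃ @h₁W @A) V c hV).P 1)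
        ((pinX hHD hI h₁ h₃ (S @hGR @η @hη @hηc @hGR₀ @hGR₁ @hGR₂ @hGR₃ @h₁W @A) V c hV).ιinf Γ)
        ((pinX hHD hI h₁ h₃ (S @hGR @η @hη @hηc @hGR₀ @hGR₁ @hGR₂ @hGR₃ @h₁W @A) V c hV).Δ Γ)
        (pinX hHD hI h₁ h₃ (S @hGR @η @hη @hηc @hGR₀ @hGR₁ @hGR₂ @hGR₃ @h₁W @A) V c hV).κ₁
        (pinX hHD hI h₁ h₃ (S @hGR @η @hη @hηc @hGR₀ @hGR₁ @hGR₂ @hGR₃ @h₁W @A) V c hV).τ₁),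
      (Sit.IsSaturated (KΓ Γ) ∧ Sit.IsStrict) → ∀ j ∈ Sit.𝓙, ∀ (k : ↥(KInfty V)) (i : Fin 2),
        ((S @hGR @η @hη @hηc @hGR₀ @hGR₁ @hGR₂ @hGR₃ @h₁W @A V c).P 1).ω
            (archIsotropyRegime V hV ι₁ V.sylvesterFrame (sylvesterFrame_formCongr V) k, 1) (j.1 (Sit.ι (LinearMap.proj i))) =
          ∑ l, (Jac ((archIsotropyProj (L : Type) V.Hm ι₁ V.sylvesterFrame (sylvesterFrame_formCongr V) k : stabilizer U21 x₀) : U21) x₀) l i •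
            j.1 (Sit.ι (LinearMap.proj l)) := by
  intro Γ Sit hadm j hj k i
  rw [archIsotropyRegime_syl_eq V hV k]
  exact hB_of_strict hHD hI h₁ h₃ (S @hGR @η @hη @hηc @hGR₀ @hGR₁ @hGR₂ @hGR₃ @h₁W @A) V c hV KΓ
    (fun k => archIsotropyProj (L : Type) V.Hm ι₁ V.sylvesterFrame (sylvesterFrame_formCongr V) k)
    (fun k => toLatticeModelG V (kInftyCorr V k)) hKΓ Γ Sit hadm j hj k i

/-- the canonical index: the correctors lie in `satLevelRegimeOf V hV (Kf Γ)` for ANY level map `Kf` (#21). -/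
theorem hKΓ_sat (Kf : Level V → Subgroup (Literature.NumberTheory.Automorphic.UnitaryGroup.finAdelic (↥(maximalRealSubfield L)) (L : Type)
      (IsCMField.complexConj L) 3 V.Hm)) :
    ∀ (Γ : Level V) (k : ↥(KInfty V)), toLatticeModelG V (kInftyCorr V k) ∈ satLevelRegimeOf V hV (Kf Γ) :=
  fun Γ k => toLatticeModelG_kInftyCorr_mem V hV (Kf Γ) k

/-- … in particular in the (Θ-sat) pin's own saturation index `(pinX …).KΓ Γ = satLevelRegimeOf V hV Γ.K` (`thetaSpaceInputIn_KΓ`, rfl). -/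
theorem hKΓ_pin :
    ∀ (Γ : Level V) (k : ↥(KInfty V)),
      toLatticeModelG V (kInftyCorr V k) ∈ (pinX hHD hI h₁ h₃ (S @hGR @η @hη @hηc @hGR₀ @hGR₁ @hGR₂ @hGR₃ @h₁W @A) V c hV).KΓ Γ :=
  fun Γ k => toLatticeModelG_kInftyCorr_mem V hV Γ.K k

/-! ## 2. RECORD 2′ at the honest pins along `K_∞` of the frame of record — every see-saw junction discharged -/

/- an ADMISSIBILITY predicate (row 14's `Gen12Residual.Adm`), spelled out, with the only property used: admissible ⇒ saturated ∧ strict -/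
variable (adm : ∀ (Γ : Level V) (k : Fin 4),
    KTypeSituation
      ((pinX hHD hI h₁ h₃ (S @hGR @η @hη @hηc @hGR₀ @hGR₁ @hGR₂ @hGR₃ @h₁W @A) V c hV).P k)
      ((pinX hHD hI h₁ h₃ (S @hGR @η @hη @hηc @hGR₀ @hGR₁ @hGR₂ @hGR₃ @h₁W @A) V c hV).ιinf Γ)
      ((pinX hHD hI h₁ h₃ (S @hGR @η @hη @hηc @hGR₀ @hGR₁ @hGR₂ @hGR₃ @h₁W @A) V c hV).Δ Γ)
      (pinX hHD hI h₁ h₃ (S @hGR @η @hη @hηc @hGR₀ @hGR₁ @hGR₂ @hGR₃ @h₁W @A) V c hV).κ₁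
      (pinX hHD hI h₁ h₃ (S @hGR @η @hη @hηc @hGR₀ @hGR₁ @hGR₂ @hGR₃ @h₁W @A) V c hV).τ₁ → Prop)

/-- **RECORD 2′ `SeesawCore` at the honest pins (W at the Sylvester frame), ALL of (x-S)/(x-W)/(x-Θ)/(K-norm) DISCHARGED** — for any
admissibility predicate whose situations are saturated at an index `KΓ` containing the correctors and strict. -/
def _root_.HodgeCM.Model.SeesawCore.ofArchSideSyl (KΓ : Level V → Subgroup (quotU V).G)
    (hKΓ : ∀ (Γ : Level V) (k : ↥(KInfty V)), toLatticeModelG V (kInftyCorr V k) ∈ KΓ Γ)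
    (hadm : ∀ (Γ : Level V) (k : Fin 4)
      (Sit : KTypeSituation
        ((pinX hHD hI h₁ h₃ (S @hGR @η @hη @hηc @hGR₀ @hGR₁ @hGR₂ @hGR₃ @h₁W @A) V c hV).P k)
        ((pinX hHD hI h₁ h₃ (S @hGR @η @hη @hηc @hGR₀ @hGR₁ @hGR₂ @hGR₃ @h₁W @A) V c hV).ιinf Γ)
        ((pinX hHD hI h₁ h₃ (S @hGR @η @hη @hηc @hGR₀ @hGR₁ @hGR₂ @hGR₃ @h₁W @A) V c hV).Δ Γ)
        (pinX hHD hI h₁ h₃ (S @hGR @η @hη @hηc @hGR₀ @hGR₁ @hGR₂ @hGR₃ @h₁W @A) V c hV).κ₁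
        (pinX hHD hI h₁ h₃ (S @hGR @η @hη @hηc @hGR₀ @hGR₁ @hGR₂ @hGR₃ @h₁W @A) V c hV).τ₁),
      adm Γ k Sit → Sit.IsSaturated (KΓ Γ) ∧ Sit.IsStrict) :
    SeesawCore hHD hI h₁ h₃ (W @hGR @hρ @η @hη @hηc @hδ @τSyl @TSyl @hTSyl) (S @hGR @η @hη @hηc @hGR₀ @hGR₁ @hGR₂ @hGR₃ @h₁W @A)
      V c hV adm :=
  SeesawCore.ofArchSideKInfty @hGR @hρ @η @hη @hηc @hδ @τSyl @TSyl @hTSyl @hGR₀ @hGR₁ @hGR₂ @hGR₃ @h₁W @A hHD hI h₁ h₃ V c hV adm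
    (fun k => Jac ((archIsotropyProj (L : Type) V.Hm ι₁ V.sylvesterFrame (sylvesterFrame_formCongr V) k : stabilizer U21 x₀) : U21) x₀)
    (fun k => det_Jac_archIsotropyProj V k)
    (fun Γ Sit had j hj k i =>
      hA_KInfty @hGR @η @hη @hηc @hGR₀ @hGR₁ @hGR₂ @hGR₃ @h₁W @A hHD hI h₁ h₃ V c hV KΓ hKΓ Γ Sit (hadm Γ 0 Sit had) j hj k i)
    (fun Γ Sit had j hj k i =>
      hB_KInfty @hGR @η @hη @hηc @hGR₀ @hGR₁ @hGR₂ @hGR₃ @h₁W @A hHD hI h₁ h₃ V c hV KΓ hKΓ Γ Sit (hadm Γ 1 Sit had) j hj k i)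

/-- **RECORD 2′ at the honest pins, NO HYPOTHESIS LEFT**: `adm Γ k Sit := Sit.IsSaturated ((pinX …).KΓ Γ) ∧ Sit.IsStrict` (the (Θ-sat) pin's
own saturation index `satLevelRegimeOf V hV Γ.K`), W at the Sylvester frame, S = period-1's term. -/
def _root_.HodgeCM.Model.SeesawCore.ofArchSidePin :
    SeesawCore hHD hI h₁ h₃ (W @hGR @hρ @η @hη @hηc @hδ @τSyl @TSyl @hTSyl) (S @hGR @η @hη @hηc @hGR₀ @hGR₁ @hGR₂ @hGR₃ @h₁W @A)
      V c hV
      (fun Γ _ Sit =>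
        Sit.IsSaturated ((pinX hHD hI h₁ h₃ (S @hGR @η @hη @hηc @hGR₀ @hGR₁ @hGR₂ @hGR₃ @h₁W @A) V c hV).KΓ Γ) ∧ Sit.IsStrict) :=
  SeesawCore.ofArchSideSyl @hGR @hρ @η @hη @hηc @hδ @hGR₀ @hGR₁ @hGR₂ @hGR₃ @h₁W @A hHD hI h₁ h₃ V c hV _
    (fun Γ => (pinX hHD hI h₁ h₃ (S @hGR @η @hη @hηc @hGR₀ @hGR₁ @hGR₂ @hGR₃ @h₁W @A) V c hV).KΓ Γ)
    (hKΓ_pin @hGR @η @hη @hηc @hGR₀ @hGR₁ @hGR₂ @hGR₃ @h₁W @A hHD hI h₁ h₃ V c hV)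
    (fun _ _ _ h => h)

end Gen12Pins

end HodgeCM.Model

end
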